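import Summits.NavierStokesRegularity.FluidComputer.PalasekTowerFaceNumbersWindowOne

/-!
# The τ₁ faces of the register as universal Navier–Stokes constants, VI: the SCALING LAWS of the faces in the rates
# `(N₀, b, β)` — what a re-tuning of the register moves (crux `EpisodeBase`, stmt-NavierStokesRegularity-19179)

Cell `ns-blowup`, seat `ns-palasek-19179-p2` (g4; holder of record of the crux `EpisodeBase` = `EpisodeBaseG` of the route
`PalasekTowerBreakdown`, line `slot`). Sequel of `PalasekTowerFaceNumbers.lean` / `…WindowOne.lean` (certified numbers for the
WIDE rates). After the stage-A instrument «OPT-𝔄-1» returned NULL-INFO ×4 (holder census v5 §7: optimised ring/tube designs at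
`Re ≤ 110` deliver sup-speed `× 1.01` and gradient `0.030` where the window-`0` letter asks `× 2.057` and `0.678`), DIRECTOR-NS g7 #32 (v)
named the planner's RE-TUNING of `(N₀, b, β)` as one of the next moves, and refuter4 g6's K128 «unit-variable squeeze» wrote the
relevant closed forms on paper: in the optimiser's units (speed unit `Y_k`, `ν = 1`) the window is `s_k = w_k Y_k² = 4b²β · log N_k ·
N_k^{β−2}` and the asked speed factor is `Y_{k+1}/Y_k = N_k^{(b−1)(β−1)}`. This file proves those laws for an ARBITRARY rates record
`R : TowerRates` (so that any proposed re-tuning is read off by `norm_num`), adds the GRADIENT face law `A_{k+1}/Y_k² = N_k^{bβ−2(β−1)}`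
and the exact «log-speed budget per unit window» `log(Y_{k+1}/Y_k) / (w_k Y_k²) = (b−1)(β−1)/(4b²β) · N_k^{−(β−2)}` — strictly
DECREASING along the tower (K128 (γ): «in the model's own currency larger `N₀` is the favourable direction») — and specialises them
to the wide rates by name (`floorAnch = 256^{13/100}`, `gradAnch 0 = 256^{−7/100}`, `windowAnch = (2783/250) · log 256 · 256^{3/10}`,
level-`0` log budget `∈ (0.00221, 0.00222)` per anchor viscous time). LABEL: E–C typing (KERNEL, exact rate algebra + certified
arithmetic). WHAT THIS IS NOT: not Navier–Stokes evidence — identities between the REGISTER's constants; nothing about any flow, about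
`EpisodeBase` or blow-up; no re-tuning is proposed here (that is the planner's call, D-0014).

References: S. Palasek, arXiv:2605.13827 §1.2, §3.3 [cite: Palasek2026ElementaryModel, §3.3]; K128 (ns-blowup STATUS 2026-08-27T05:22Z).
-/

noncomputable section

namespace Summit.NavierStokesRegularity.FluidComputer.PalasekTowerClayBridge

open Set MeasureTheory Filter Topology Function
open scoped ENNReal ContDiff NNReal
open Literature.Analysis.FluidPDE

/-! ## §7 Scaling laws of the faces for an arbitrary rates record -/

namespace TowerRates

variable (R : TowerRates)

/-- **Speed face law**: `Y_{k+1} / Y_k = N_k^{(b−1)(β−1)}` (the factor the level-`k+1` speed floor asks of a datum of sup speed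
`Y_k`). [cite: Palasek2026ElementaryModel, §1.2] -/
theorem Y_succ_div_Y (k : ℕ) : R.Y (k + 1) / R.Y k = R.N k ^ ((R.b - 1) * (R.β - 1)) := by
  have hY : 0 < R.Y k := Real.rpow_pos_of_pos (R.N_pos k) _
  rw [div_eq_iff hY.ne', R.Y_succ k]

/-- `log (Y_{k+1}/Y_k) = (b−1)(β−1) · log N_k`. [folklore] -/
theorem log_Y_succ_div_Y (k : ℕ) :
    Real.log (R.Y (k + 1) / R.Y k) = (R.b - 1) * (R.β - 1) * Real.log (R.N k) := by
  rw [R.Y_succ_div_Y k, Real.log_rpow (R.N_pos k)]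

/-- `Y_k² = A_k · N_k^{β−2}` (the anchored speed unit squared, in amplitude units). [folklore] -/
theorem Y_sq_eq (k : ℕ) : R.Y k ^ 2 = R.A k * R.N k ^ (R.β - 2) := by
  have hN : 0 < R.N k := R.N_pos k
  simp only [TowerRates.Y, TowerRates.A]
  rw [sq, ← Real.rpow_add hN, ← Real.rpow_add hN]
  congr 1
  ring

/-- `A_{k+1} = N_k^{bβ}`. [folklore] -/
theorem A_succ_eq (k : ℕ) : R.A (k + 1) = R.N k ^ (R.b * R.β) := by
  simp only [TowerRates.A]
  rw [R.N_succ k, ← Real.rpow_mul (R.N_pos k).le]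

/-- **Gradient face law**: `A_{k+1} / Y_k² = N_k^{bβ − 2(β−1)}` (the strain floor the level-`k+1` letter asks, in the anchored gradient
unit `Y_k²/ν`). [cite: Palasek2026ElementaryModel, §3.1] -/
theorem A_succ_div_Y_sq (k : ℕ) : R.A (k + 1) / R.Y k ^ 2 = R.N k ^ (R.b * R.β - 2 * (R.β - 1)) := by
  have hN : 0 < R.N k := R.N_pos k
  have hY2 : R.Y k ^ 2 = R.N k ^ (2 * (R.β - 1)) := by
    simp only [TowerRates.Y]
    rw [sq, ← Real.rpow_add hN]
    congr 1
    ring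
  rw [R.A_succ_eq k, hY2, ← Real.rpow_sub hN]

/-- **Window law** (K128 (α)/(β)): `w_k · Y_k² = 4b²β · log N_k · N_k^{β−2}` — the growth window of level `k+1` measured in the
viscous time unit `ν/Y_k²` of the level-`k` anchor. [cite: Palasek2026ElementaryModel, §3.3] -/
theorem window_mul_Y_sq (k : ℕ) :
    R.window k * R.Y k ^ 2 = 4 * R.b ^ 2 * R.β * Real.log (R.N k) * R.N k ^ (R.β - 2) := by
  have hA : R.A k ≠ 0 := (R.A_pos k).ne'
  have hw : R.window k = 4 * R.b * R.β * Real.log (R.N (k + 1)) / R.A k := rfl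
  rw [hw, R.log_N_succ k, R.Y_sq_eq k]
  field_simp

/-- The window in anchored units is positive. [folklore] -/
theorem window_mul_Y_sq_pos (k : ℕ) : 0 < R.window k * R.Y k ^ 2 :=
  mul_pos (R.window_pos k) (pow_pos (Real.rpow_pos_of_pos (R.N_pos k) _) 2)

/-- **Log-speed budget per unit window** (K128 (γ), exact): `log(Y_{k+1}/Y_k) / (w_k Y_k²) = (b−1)(β−1) / (4b²β) / N_k^{β−2}` —
the logarithmic sup-speed amplification the letter asks PER anchor viscous time. [folklore] -/
theorem log_Y_succ_div_Y_div_window (k : ℕ) :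
    Real.log (R.Y (k + 1) / R.Y k) / (R.window k * R.Y k ^ 2) =
      (R.b - 1) * (R.β - 1) / (4 * R.b ^ 2 * R.β) / R.N k ^ (R.β - 2) := by
  have hlog : Real.log (R.N k) ≠ 0 := (R.log_N_pos k).ne'
  have hNp : R.N k ^ (R.β - 2) ≠ 0 := (Real.rpow_pos_of_pos (R.N_pos k) _).ne'
  have hb : R.b ≠ 0 := by have := R.one_lt_b; positivity
  have hβ : R.β ≠ 0 := by have := R.two_lt_β; positivity
  rw [R.log_Y_succ_div_Y k, R.window_mul_Y_sq k]
  field_simp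

/-- The scales increase strictly: `N_k < N_{k+1}`. [cite: Palasek2026ElementaryModel, §1.2] -/
theorem N_lt_N_succ (k : ℕ) : R.N k < R.N (k + 1) := by
  rw [R.N_succ k]
  conv_lhs => rw [← Real.rpow_one (R.N k)]
  exact Real.rpow_lt_rpow_of_exponent_lt (R.one_lt_N k) R.one_lt_b

/-- **The budget per unit window DECREASES along the tower** (`β > 2`): level `k+1` asks a smaller log-speed amplification per
anchor viscous time than level `k` — the base episode is the tightest in this currency. [folklore] -/
theorem log_Y_succ_div_Y_div_window_succ_lt (k : ℕ) :
    Real.log (R.Y (k + 2) / R.Y (k + 1)) / (R.window (k + 1) * R.Y (k + 1) ^ 2) <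
      Real.log (R.Y (k + 1) / R.Y k) / (R.window k * R.Y k ^ 2) := by
  rw [show k + 2 = (k + 1) + 1 from rfl, R.log_Y_succ_div_Y_div_window (k + 1), R.log_Y_succ_div_Y_div_window k]
  have hb := R.one_lt_b
  have hβ := R.two_lt_β
  have hc : 0 < (R.b - 1) * (R.β - 1) / (4 * R.b ^ 2 * R.β) := by
    apply div_pos (mul_pos (by linarith) (by linarith)); positivity
  have h0 : 0 < R.N k ^ (R.β - 2) := Real.rpow_pos_of_pos (R.N_pos k) _
  have hlt : R.N k ^ (R.β - 2) < R.N (k + 1) ^ (R.β - 2) :=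
    Real.rpow_lt_rpow (R.N_pos k).le (R.N_lt_N_succ k) (by linarith)
  exact div_lt_div_of_pos_left hc h0 hlt

end TowerRates

/-! ## §8 The wide rates: the anchored faces of `UniversalFace` as powers of `N₀ = 256` -/

namespace UniversalFace

open TowerRates

/-- `floorAnch = N₀^{(b−1)(β−1)}` on the wide rates. [folklore] -/
theorem floorAnch_eq_N_rpow : floorAnch = wide.N 0 ^ ((wide.b - 1) * (wide.β - 1)) := by
  have h : floorAnch = wide.Y (0 + 1) / wide.Y 0 := rfl
  rw [h, wide.Y_succ_div_Y 0]

/-- `floorAnch = 256^{13/100}` (the card's `256^{0.13} = 2.056`). [folklore] -/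
theorem floorAnch_eq_rpow : floorAnch = (256 : ℝ) ^ ((13 : ℝ) / 100) := by
  rw [floorAnch_eq_N_rpow, wide_N_zero]
  norm_num [wide]

/-- `gradAnch 0 = N₀^{bβ − 2(β−1)}` on the wide rates. [folklore] -/
theorem gradAnch_zero_eq_N_rpow : gradAnch 0 = wide.N 0 ^ (wide.b * wide.β - 2 * (wide.β - 1)) := by
  have h : gradAnch 0 = wide.A (0 + 1) / wide.Y 0 ^ 2 := rfl
  rw [h, wide.A_succ_div_Y_sq 0]

/-- `gradAnch 0 = 256^{−7/100}` (`bβ − 2(β−1) = 253/100 − 260/100`; `≈ 0.678`). [folklore] -/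
theorem gradAnch_zero_eq_rpow : gradAnch 0 = (256 : ℝ) ^ (-(7 : ℝ) / 100) := by
  rw [gradAnch_zero_eq_N_rpow, wide_N_zero]
  norm_num [wide]

/-- The `UniversalFace` window is the general `TowerRates.window` of the wide rates. [folklore] -/
theorem window_eq_towerRates_window (k : ℕ) : window k = wide.window k := rfl

/-- **Level `k` window in its own anchored units** (K128 (β)): `w_k Y_k² = 4b²β · log N_k · N_k^{β−2}` on the wide rates.
[cite: Palasek2026ElementaryModel, §3.3] -/
theorem window_mul_Y_sq_eq (k : ℕ) :
    window k * wide.Y k ^ 2 = 4 * wide.b ^ 2 * wide.β * Real.log (wide.N k) * wide.N k ^ (wide.β - 2) := by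
  rw [window_eq_towerRates_window, wide.window_mul_Y_sq k]

/-- `windowAnch = 4b²β · log N₀ · N₀^{β−2}` (K128 (α): `11.132 × 5.545 × 5.278 = 325.8`). [folklore] -/
theorem windowAnch_eq_closed :
    windowAnch = 4 * wide.b ^ 2 * wide.β * Real.log (wide.N 0) * wide.N 0 ^ (wide.β - 2) := by
  have h : windowAnch = window 0 * wide.Y 0 ^ 2 := rfl
  rw [h, window_mul_Y_sq_eq 0]

/-- `windowAnch = (2783/250) · log 256 · 256^{3/10}` (`4b²β = 4 · (121/100) · (23/10) = 2783/250 = 11.132`). [folklore] -/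
theorem windowAnch_eq_rpow : windowAnch = (2783 / 250) * Real.log 256 * (256 : ℝ) ^ ((3 : ℝ) / 10) := by
  rw [windowAnch_eq_closed, wide_N_zero]
  norm_num [wide]

/-- **Level-`0` log-speed budget per anchor viscous time**: `log floorAnch / windowAnch = (13/100) / ((2783/250) · log 256 · 256^{3/10})
= (b−1)(β−1)/(4b²β) / N₀^{β−2}`. [folklore] -/
theorem log_floorAnch_div_windowAnch_eq :
    Real.log floorAnch / windowAnch = (wide.b - 1) * (wide.β - 1) / (4 * wide.b ^ 2 * wide.β) / wide.N 0 ^ (wide.β - 2) := by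
  have h1 : floorAnch = wide.Y (0 + 1) / wide.Y 0 := rfl
  have h2 : windowAnch = wide.window 0 * wide.Y 0 ^ 2 := rfl
  rw [h1, h2, wide.log_Y_succ_div_Y_div_window 0]

/-- `log floorAnch / windowAnch ∈ (0.00221, 0.00222)`: the window-`0` letter asks `≈ 2.2 · 10⁻³` of log-sup-speed per anchor viscous
time (`= 0.13 / (11.132 · N₀^{0.3})`, `N₀^{0.3} ∈ (5.278, 5.279)`). [folklore] -/
theorem log_floorAnch_div_windowAnch_bounds :
    0.00221 < Real.log floorAnch / windowAnch ∧ Real.log floorAnch / windowAnch < 0.00222 := by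
  rw [log_floorAnch_div_windowAnch_eq]
  have hc : (wide.b - 1) * (wide.β - 1) / (4 * wide.b ^ 2 * wide.β) = 13 / 1113.2 := by norm_num [wide]
  rw [hc]
  have hlo : (5.278 : ℝ) < wide.N 0 ^ (wide.β - 2) := by
    rw [TowerRates.wide_N_rpow_sub_two_eq_two_rpow, pow_zero, mul_one]
    exact TowerRates.lt_two_rpow_of_pow_lt (a := 12) (m := 1) (r := 5) (by norm_num) (by norm_num)
  have hhi : wide.N 0 ^ (wide.β - 2) < 5.279 := by
    rw [TowerRates.wide_N_rpow_sub_two_eq_two_rpow, pow_zero, mul_one]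
    exact TowerRates.two_rpow_lt_of_pow_lt (by norm_num) (a := 12) (m := 1) (r := 5) (by norm_num) (by norm_num)
  have hpos : 0 < wide.N 0 ^ (wide.β - 2) := by linarith
  constructor
  · rw [lt_div_iff₀ hpos]; nlinarith
  · rw [div_lt_iff₀ hpos]; nlinarith

/-- **The level-`1` budget is smaller** (instance of `log_Y_succ_div_Y_div_window_succ_lt`): item 19249's window asks less log-speed
per level-`1` anchor viscous time than 19179's. [folklore] -/
theorem log_budget_one_lt_zero :
    Real.log (wide.Y 2 / wide.Y 1) / (wide.window 1 * wide.Y 1 ^ 2) < Real.log floorAnch / windowAnch := by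
  have h1 : floorAnch = wide.Y (0 + 1) / wide.Y 0 := rfl
  have h2 : windowAnch = wide.window 0 * wide.Y 0 ^ 2 := rfl
  rw [h1, h2]
  exact wide.log_Y_succ_div_Y_div_window_succ_lt 0

end UniversalFace

end Summit.NavierStokesRegularity.FluidComputer.PalasekTowerClayBridge

end
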